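/-
COR-CM (cell pub-hodgecm2, stage 2 of the Hodge ladder) — count-neutral KERNEL COMBINATORICS «census ↔ tree dictionary, part 1:
bitmask lemmas» (seat prover-pub-hodgecm2-b23-g32-0, binder prover b23, gen 32; claim INT2-TRANSPORT, HOME/lit/LIT-STATUS.md
2026-08-21T15:20:31Z).  Pure finite combinatorics over seat b30's census engine (`Census/FaceSquaresModel.lean` p274598,
`Census/FaceSquaresLattice.lean` p276167), whose primitives are used BY NAME (`mem`, `bit`, `imageMask`, `flipAt`, `encode`,
`normalize`, `isCMType`, `cmTypes`, `placeMask`, `places`, `faces`); nothing of theirs is restated or re-filed.  Theorems only; no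
field, no geometry, no definition, no named fact, nothing asserted.  `Interfaces.lean` (C1), every E term, B01 and `Transposition/*`
are untouched.  HONEST FRAMING (COORDINATOR RULING — HODGE FRAMING CORRECTION, 2026-08-21T11:55:35Z): `HC_CM` is NOT proved,
here or anywhere in the tree.
-/
import Summits.HodgeConjecture.CorCM.Census.FaceSquaresLattice
import HarnessLib

/-!
# Bitmask lemmas for the finite face-square model (census ↔ tree dictionary, part 1)

Seat b30's census computes in a Galois CM closure type `(G, c)` given as a Cayley table `Γ : CMGaloisType n` on `Fin n`, with CM
types as bitmasks `T < 2^n` (`mem i T` = bit `i`), places as the masks `placeMask i = {g_i, c g_i}`, images `imageMask`,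
flips `flipAt` (= `xor`), and faces as triples of masks (`Γ.faces`).  Everything there is a closed `Bool`/`ℕ` computation decided
in the kernel per type.  To TRANSPORT those computations to a Galois CM field (`CorCM/FaceCensusDictionary.lean`,
`CorCM/FaceCensusTransport.lean`) one needs the elementary specification lemmas of the primitives, proved here once for every
`n` and every table: membership in `bit`/`|||`/`flipAt`/`imageMask`/`encode`/`placeMask`, the bounds `< 2^n`, extensionality of
masks below `2^n`, and membership in the lists `normalize`, `cmTypes`, `places`, `faces`.

References: [cite: Pohlmann1968, Thm. 1] (the exponent-vector / label dictionary these masks encode, via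
`Census/FaceSquaresModel.lean`).
-/

namespace Summit.HodgeConjecture.CorCM.FaceCensus

open Summit.HodgeConjecture.CorCM.Census.FaceSquaresModel

/-! ## §0 Bitmask lemmas for the finite model -/

section Masks

variable {n : ℕ}

/-- Two Booleans with equivalent truth are equal. [folklore] -/
theorem bool_eq_of_iff {a b : Bool} (h : a = true ↔ b = true) : a = b := by
  cases a <;> cases b <;> simp_all

/-- `mem i {g_j} ↔ i = j`. [folklore] -/
theorem mem_bit (i j : Fin n) : mem i (bit j) = true ↔ i = j := by
  unfold mem bit
  rw [Nat.testBit_two_pow, decide_eq_true_iff, Fin.ext_iff]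
  exact eq_comm

/-- The empty mask has no members. [folklore] -/
theorem mem_zero (i : Fin n) : mem i 0 = false := Nat.zero_testBit i.val

/-- Membership in a union of masks. [folklore] -/
theorem mem_lor (i : Fin n) (a b : ℕ) : mem i (a ||| b) = (mem i a || mem i b) := Nat.testBit_lor a b i.val

/-- Membership in a flipped mask is the exclusive or. [folklore] -/
theorem mem_flipAt (i : Fin n) (π T : ℕ) : mem i (flipAt π T) = (mem i T ^^ mem i π) := Nat.testBit_xor T π i.val

/-- A singleton mask is below `2^n`. [folklore] -/
theorem bit_lt (j : Fin n) : bit j < 2 ^ n := Nat.pow_lt_pow_right Nat.one_lt_two j.isLt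

/-- The accumulator form of `imageMask`: membership. [folklore] -/
theorem mem_foldl_image (f : Fin n → Fin n) (T : ℕ) (k : Fin n) (l : List (Fin n)) (acc : ℕ) :
    mem k (l.foldl (fun acc i => if mem i T then acc ||| bit (f i) else acc) acc) = true ↔
      mem k acc = true ∨ ∃ i ∈ l, mem i T = true ∧ f i = k := by
  induction l generalizing acc with
  | nil => simp
  | cons a l ih =>
    rw [List.foldl_cons, ih]
    by_cases ha : mem a T = true
    · rw [if_pos ha, mem_lor, Bool.or_eq_true, mem_bit]
      constructor
      · rintro ((h | h) | ⟨i, hi, h⟩)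
        · exact Or.inl h
        · exact Or.inr ⟨a, List.mem_cons_self, ha, h.symm⟩
        · exact Or.inr ⟨i, List.mem_cons_of_mem a hi, h⟩
      · rintro (h | ⟨i, hi, hT, hf⟩)
        · exact Or.inl (Or.inl h)
        · rcases List.mem_cons.mp hi with rfl | hi
          · exact Or.inl (Or.inr hf.symm)
          · exact Or.inr ⟨i, hi, hT, hf⟩
    · rw [if_neg ha]
      constructor
      · rintro (h | ⟨i, hi, h⟩)
        · exact Or.inl h
        · exact Or.inr ⟨i, List.mem_cons_of_mem a hi, h⟩
      · rintro (h | ⟨i, hi, hT, hf⟩)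
        · exact Or.inl h
        · rcases List.mem_cons.mp hi with rfl | hi
          · exact absurd hT ha
          · exact Or.inr ⟨i, hi, hT, hf⟩

/-- Membership in the image of a mask under a map of `G`. [folklore] -/
theorem mem_imageMask (f : Fin n → Fin n) (T : ℕ) (k : Fin n) :
    mem k (imageMask f T) = true ↔ ∃ i, mem i T = true ∧ f i = k := by
  unfold imageMask
  rw [mem_foldl_image, mem_zero]
  simp [List.mem_finRange]

/-- The accumulator form of `imageMask`: bound. [folklore] -/
theorem foldl_image_lt (f : Fin n → Fin n) (T : ℕ) (l : List (Fin n)) {acc : ℕ} (hacc : acc < 2 ^ n) :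
    l.foldl (fun acc i => if mem i T then acc ||| bit (f i) else acc) acc < 2 ^ n := by
  induction l generalizing acc with
  | nil => exact hacc
  | cons a l ih =>
    rw [List.foldl_cons]
    apply ih
    split_ifs
    · exact Nat.or_lt_two_pow hacc (bit_lt (f a))
    · exact hacc

/-- The image of a mask is below `2^n`. [folklore] -/
theorem imageMask_lt (f : Fin n → Fin n) (T : ℕ) : imageMask f T < 2 ^ n :=
  foldl_image_lt f T _ (Nat.two_pow_pos n)

/-- The accumulator form of `encode`: membership. [folklore] -/
theorem mem_foldl_encode (k : Fin n) (l : List (Fin n)) (acc : ℕ) :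
    mem k (l.foldl (fun acc i => acc ||| bit i) acc) = true ↔ mem k acc = true ∨ k ∈ l := by
  induction l generalizing acc with
  | nil => simp
  | cons a l ih =>
    rw [List.foldl_cons, ih, mem_lor, Bool.or_eq_true, mem_bit, List.mem_cons, or_assoc]

/-- Membership in the mask of a list of indices. [folklore] -/
theorem mem_encode (k : Fin n) (l : List (Fin n)) : mem k (encode l) = true ↔ k ∈ l := by
  unfold encode
  rw [mem_foldl_encode, mem_zero]
  simp

/-- The mask of a list of indices is below `2^n`. [folklore] -/
theorem encode_lt (l : List (Fin n)) : encode l < 2 ^ n := by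
  unfold encode
  suffices h : ∀ acc < 2 ^ n, l.foldl (fun acc i => acc ||| bit i) acc < 2 ^ n from h 0 (Nat.two_pow_pos n)
  induction l with
  | nil => intro acc h; exact h
  | cons a l ih => intro acc h; rw [List.foldl_cons]; exact ih _ (Nat.or_lt_two_pow h (bit_lt a))

/-- A mask below `2^n` has no bit at or beyond `n`. [folklore] -/
theorem testBit_eq_false_of_lt {T : ℕ} (hT : T < 2 ^ n) {j : ℕ} (hj : n ≤ j) : T.testBit j = false :=
  Nat.testBit_lt_two_pow (lt_of_lt_of_le hT (Nat.pow_le_pow_right Nat.two_pos hj))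

/-- Masks below `2^n` with the same members are equal. [folklore] -/
theorem eq_of_mem_iff {T T' : ℕ} (hT : T < 2 ^ n) (hT' : T' < 2 ^ n)
    (h : ∀ i : Fin n, mem i T = true ↔ mem i T' = true) : T = T' := by
  apply Nat.eq_of_testBit_eq
  intro j
  by_cases hj : j < n
  · exact bool_eq_of_iff (h ⟨j, hj⟩)
  · rw [testBit_eq_false_of_lt hT (not_lt.mp hj), testBit_eq_false_of_lt hT' (not_lt.mp hj)]

/-- A flipped mask is below `2^n`. [folklore] -/
theorem flipAt_lt {π T : ℕ} (hπ : π < 2 ^ n) (hT : T < 2 ^ n) : flipAt π T < 2 ^ n := Nat.xor_lt_two_pow hT hπ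

variable (Γ : CMGaloisType n)

/-- Membership in the place mask `{g_i, c g_i}`. [folklore] -/
theorem mem_placeMask (k i : Fin n) : mem k (Γ.placeMask i) = true ↔ k = i ∨ k = Γ.mul Γ.conj i := by
  unfold CMGaloisType.placeMask
  rw [mem_lor, Bool.or_eq_true, mem_bit, mem_bit]

/-- A place mask is below `2^n`. [folklore] -/
theorem placeMask_lt (i : Fin n) : Γ.placeMask i < 2 ^ n := Nat.or_lt_two_pow (bit_lt i) (bit_lt _)

/-- Membership in the list of CM types. [folklore] -/
theorem mem_cmTypes_iff (T : ℕ) : T ∈ Γ.cmTypes ↔ T < 2 ^ n ∧ Γ.isCMType T = true := by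
  unfold CMGaloisType.cmTypes
  rw [List.mem_filter, List.mem_range]

omit Γ in
/-- Membership in a sorted insertion. [folklore] -/
theorem mem_insertNat (a b : ℕ) (l : List ℕ) : a ∈ insertNat b l ↔ a = b ∨ a ∈ l := by
  induction l with
  | nil => simp [insertNat]
  | cons c l ih =>
    simp only [insertNat]
    split_ifs
    · simp only [List.mem_cons]
    · rw [List.mem_cons, ih, List.mem_cons]; tauto

omit Γ in
/-- Insertion sort preserves membership. [folklore] -/
theorem mem_sortNat (a : ℕ) (l : List ℕ) : a ∈ sortNat l ↔ a ∈ l := by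
  induction l with
  | nil => simp [sortNat]
  | cons c l ih => simp only [sortNat]; rw [mem_insertNat, ih, List.mem_cons]

omit Γ in
/-- The normal form of a list of masks has the same members. [folklore] -/
theorem mem_normalize (a : ℕ) (l : List ℕ) : a ∈ Census.FaceSquaresModel.normalize l ↔ a ∈ l := by
  unfold Census.FaceSquaresModel.normalize
  rw [List.mem_eraseDups, mem_sortNat]

/-- Every place mask is one of the places. [folklore] -/
theorem placeMask_mem_places (i : Fin n) : Γ.placeMask i ∈ Γ.places := by
  unfold CMGaloisType.places
  rw [mem_normalize, List.mem_map]
  exact ⟨i, List.mem_finRange i, rfl⟩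

/-- A CM type and two distinct places form a face of the model. [folklore] -/
theorem mem_faces_of {T p q : ℕ} (hT : T ∈ Γ.cmTypes) (hp : p ∈ Γ.places) (hq : q ∈ Γ.places) (hqp : q ≠ p) :
    (T, p, q) ∈ Γ.faces := by
  unfold CMGaloisType.faces
  rw [List.mem_flatMap]
  refine ⟨T, hT, ?_⟩
  rw [List.mem_flatMap]
  refine ⟨p, hp, ?_⟩
  rw [List.mem_map]
  refine ⟨q, ?_, rfl⟩
  rw [List.mem_filter]
  exact ⟨hq, bne_iff_ne.mpr hqp⟩

omit Γ in
/-- Four mutually exclusive unit indicators add up to the indicator of their disjunction. [folklore] -/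
theorem ite_add_four {P0 P1 P2 P3 : Prop} [Decidable P0] [Decidable P1] [Decidable P2] [Decidable P3]
    (h01 : ¬(P0 ∧ P1)) (h02 : ¬(P0 ∧ P2)) (h03 : ¬(P0 ∧ P3)) (h12 : ¬(P1 ∧ P2)) (h13 : ¬(P1 ∧ P3))
    (h23 : ¬(P2 ∧ P3)) :
    ((if P0 then 1 else 0) + (if P1 then 1 else 0) + (if P2 then 1 else 0) + (if P3 then 1 else 0) : ℤ) =
      if P0 ∨ P1 ∨ P2 ∨ P3 then 1 else 0 := by
  by_cases p0 : P0 <;> by_cases p1 : P1 <;> by_cases p2 : P2 <;> by_cases p3 : P3 <;> simp_all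

end Masks

end Summit.HodgeConjecture.CorCM.FaceCensus
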